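import Summits.HubbardSuperconductivity.HubbardSuperconductivity.Theorems.JosephsonMirrorJmInterchangeWindowPigeonhole
import Summits.HubbardSuperconductivity.HubbardSuperconductivity.Theorems.JosephsonMirrorJmInterchangeCouplingBound
import Summits.HubbardSuperconductivity.HubbardSuperconductivity.Theorems.JosephsonMirrorJmInterchangeHypGivesZEPO
import Summits.HubbardSuperconductivity.HubbardSuperconductivity.Theorems.JosephsonMirrorJmInterchangeZepoGivesHyp
import Summits.HubbardSuperconductivity.HubbardSuperconductivity.Theorems.JosephsonMirrorJmInterchangeBridgeApprox

/-!
# Route `JosephsonMirror` — crux `JmInterchange` (stmt-HubbardSuperconductivity-2227), line `Sketch`: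
# the NORMAL FORM of the crux and the line's RESIDUAL, by name

Two pure-logic consequences of the five landed stubs of line `Sketch` (idea card
`strip-the-mirror-pair-removal-bridge`; lead skeleton `Cruxes/JmInterchange/Lines/Sketch.lean`), stated on the
route declaration `Theses.JosephsonMirror.JmInterchange` itself:

* `jmInterchange_iff_singleLayerForm` — THE MIRROR IS ELIMINABLE: the crux (uniform linear Josephson gain of the
  window double ⇒ ground-floor pair bridge, universally in `(U, δ)`) is EQUIVALENT to the single-layer statement
  "zero-excess `d`-wave pair order ⇒ ground-floor pair bridge" at every `(U, δ)`, in which neither the Kronecker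
  double, nor the window, nor `μ_L`, nor `J` occurs.  Forward half: `hypGivesZEPO_of_pigeonhole` with
  `windowPigeonhole`, `couplingExpectBound` (column pigeonhole on the PSD minimiser + Feynman–Hellmann); backward
  half: `zepoGivesHyp` (window trial pair).
* `jmInterchange_of_floorOrder_of_windowInputs` — THE RESIDUAL: the crux follows from two single-layer MODEL
  statements alone — (R1) zero-excess pair order reaches the ground floor (the Koma–Tasaki core), and (R2) at some
  scale `γ_L` with `γ_L L² → ∞`, approximate low-lying orthogonality of `Δ_d g` in sector `(N_L − 2, 0)` together
  with the charging floor `2e(N_L) − e(N_L+2) − e(N_L−2) ≤ εγ_L` — via the landed engine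
  `bridgeFromFloorOrderApprox` (pair-transfer rung + spectral Markov).  Neither (R1) nor (R2) is claimed here.

Sources: T. Koma, H. Tasaki, J. Stat. Phys. 76 (1994) 745 (SSB ⇔ LRO, double-commutator method); E. H. Lieb,
PRL 62 (1989) 1201 (`W`-matrix packaging); H. Tasaki, J. Stat. Phys. 174 (2019) 735 (tower states).  No new
definitions; all statements are spelled out on the tree's vocabulary.
-/

-- the mandated namespace `Summit.<Summit>.<Problem>.Theorems` repeats `HubbardSuperconductivity`
-- (single-problem summit, D-0017), which the `dupNamespace` linter flags on every declaration
set_option linter.dupNamespace false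

namespace Summit.HubbardSuperconductivity.HubbardSuperconductivity.Theorems.JosephsonMirror

open Matrix Literature.MathematicalPhysics.QuantumLattice Filter
open Summit.HubbardSuperconductivity.HubbardSuperconductivity.Theses.JosephsonMirror (JmInterchange)
open scoped Kronecker

/-- **Normal form of the crux `JmInterchange` (the mirror is eliminable).**  `JmInterchange` holds iff, for every
`U > 0` and `δ ∈ (0, 1/2)`, ZERO-EXCESS PAIR ORDER at `(U, δ)` — some `c > 0` such that for every `ε > 0`,
eventually in even `L`, a unit vector `v` of sector `N_L` or `N_L − 2` (`S^z = 0`) has energy within `εL²` of its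
sector floor and `‖Δ_d v‖² ≥ cL⁴` — implies the GROUND-FLOOR PAIR BRIDGE at `(U, δ)` (the conclusion of the crux,
verbatim).  (`→`: a zero-excess vector and its pair-removed partner give the Josephson gain, `zepoGivesHyp`, then
apply the crux; `←`: the gain gives zero-excess pair order, `hypGivesZEPO_of_pigeonhole`.)  Koma–Tasaki (1994);
Lieb (1989). [folklore] -/
theorem jmInterchange_iff_singleLayerForm :
    JmInterchange ↔
      ∀ (U δ : ℝ), 0 < U → δ ∈ Set.Ioo (0:ℝ) (1 / 2) →
        (∃ c : ℝ, 0 < c ∧ ∀ ε : ℝ, 0 < ε → ∃ L₀ : ℕ, ∀ (L : ℕ) [NeZero L], Even L → L₀ ≤ L →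
            ∃ n : ℕ, (n = (2 * ⌊(1 - δ) * (L : ℝ) ^ 2 / 2⌋₊) ∨ n = (2 * ⌊(1 - δ) * (L : ℝ) ^ 2 / 2⌋₊) - 2) ∧
              ∃ v : Fock (Orb (FermionTorus 2 L)), v ∈ szSector n 0 ∧ star v ⬝ᵥ v = 1 ∧
                (star v ⬝ᵥ (hubbardTorus 2 L 1 U *ᵥ v)).re ≤
                    (hubbardTorus 2 L 1 U).minEnergyOn (szSector n 0) + ε * (L : ℝ) ^ 2 ∧
                c * (L : ℝ) ^ 4 ≤
                  (star (pairField dWaveFormFactor L *ᵥ v) ⬝ᵥ (pairField dWaveFormFactor L *ᵥ v)).re) →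
        ∃ a' : ℝ, 0 < a' ∧ ∃ L₀ : ℕ, ∀ (L : ℕ) [NeZero L], Even L → L₀ ≤ L → ∃ φ χ : Literature.MathematicalPhysics.QuantumLattice.Fock (Literature.MathematicalPhysics.QuantumLattice.Orb (Literature.MathematicalPhysics.QuantumLattice.FermionTorus 2 L)), Literature.MathematicalPhysics.QuantumLattice.IsGroundStateInSector (Literature.MathematicalPhysics.QuantumLattice.hubbardTorus 2 L 1 U) (2 * ⌊(1 - δ) * (L : ℝ) ^ 2 / 2⌋₊) 0 φ ∧ star φ ⬝ᵥ φ = 1 ∧ Literature.MathematicalPhysics.QuantumLattice.IsGroundStateInSector (Literature.MathematicalPhysics.QuantumLattice.hubbardTorus 2 L 1 U) (2 * ⌊(1 - δ) * (L : ℝ) ^ 2 / 2⌋₊ - 2) 0 χ ∧ star χ ⬝ᵥ χ = 1 ∧ a' * (L : ℝ) ^ 4 ≤ ‖star χ ⬝ᵥ Matrix.mulVec (Literature.MathematicalPhysics.QuantumLattice.pairField Literature.MathematicalPhysics.QuantumLattice.dWaveFormFactor L) φ‖ ^ 2 := by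
  constructor
  · intro h U δ hU hδ hZ
    unfold JmInterchange at h
    obtain ⟨a, J₀, ha, hJ₀, hG⟩ := zepoGivesHyp U δ hU hδ hZ
    exact h U δ a J₀ hU hδ ha hJ₀ hG
  · intro h
    unfold JmInterchange
    intro U δ a J₀ hU hδ ha hJ₀ hG
    exact h U δ hU hδ
      (hypGivesZEPO_of_pigeonhole (fun {ι} _ _ => windowPigeonhole) (fun {ι} _ _ => couplingExpectBound)
        U δ a J₀ hU hδ ha hJ₀ hG)

/-- **Residual of line `Sketch` for the crux `JmInterchange`.**  The crux follows from the two single-layer model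
statements (R1) "zero-excess pair order reaches the ground floor" (FLOOR ORDER: eventually some unit ground state
`g` of `(N_L, 0)` has `‖Δ_d g‖² ≥ cL⁴`) and (R2) "at some scale `γ_L` with `γ_L L² → ∞`: the spectral weight of
`Δ_d g` on eigenvalues of `H` in the open window `(e(N_L−2), e(N_L−2) + γ_L)` is at most a quarter of `‖Δ_d g‖²`
for every ground state `g` of `(N_L, 0)`, and `2e(N_L) − e(N_L+2) − e(N_L−2) ≤ εγ_L` eventually for every
`ε > 0`".  Composition of `hypGivesZEPO_of_pigeonhole` (gain ⇒ zero-excess order), (R1), (R2) and the engine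
`bridgeFromFloorOrderApprox`.  Koma–Tasaki (1994). [folklore] -/
theorem jmInterchange_of_floorOrder_of_windowInputs
    (h₂ : ∀ (U δ : ℝ), 0 < U → δ ∈ Set.Ioo (0:ℝ) (1 / 2) →
      (∃ c : ℝ, 0 < c ∧ ∀ ε : ℝ, 0 < ε → ∃ L₀ : ℕ, ∀ (L : ℕ) [NeZero L], Even L → L₀ ≤ L →
            ∃ n : ℕ, (n = (2 * ⌊(1 - δ) * (L : ℝ) ^ 2 / 2⌋₊) ∨ n = (2 * ⌊(1 - δ) * (L : ℝ) ^ 2 / 2⌋₊) - 2) ∧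
              ∃ v : Fock (Orb (FermionTorus 2 L)), v ∈ szSector n 0 ∧ star v ⬝ᵥ v = 1 ∧
                (star v ⬝ᵥ (hubbardTorus 2 L 1 U *ᵥ v)).re ≤
                    (hubbardTorus 2 L 1 U).minEnergyOn (szSector n 0) + ε * (L : ℝ) ^ 2 ∧
                c * (L : ℝ) ^ 4 ≤
                  (star (pairField dWaveFormFactor L *ᵥ v) ⬝ᵥ (pairField dWaveFormFactor L *ᵥ v)).re) →
      ∃ c : ℝ, 0 < c ∧ ∃ L₀ : ℕ, ∀ (L : ℕ) [NeZero L], Even L → L₀ ≤ L →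
          ∃ g : Fock (Orb (FermionTorus 2 L)), IsGroundStateInSector (hubbardTorus 2 L 1 U) (2 * ⌊(1 - δ) * (L : ℝ) ^ 2 / 2⌋₊) 0 g ∧
            star g ⬝ᵥ g = 1 ∧
            c * (L : ℝ) ^ 4 ≤
              (star (pairField dWaveFormFactor L *ᵥ g) ⬝ᵥ (pairField dWaveFormFactor L *ᵥ g)).re)
    (h₃ : ∀ (U δ : ℝ), 0 < U → δ ∈ Set.Ioo (0:ℝ) (1 / 2) →
      (∃ c : ℝ, 0 < c ∧ ∃ L₀ : ℕ, ∀ (L : ℕ) [NeZero L], Even L → L₀ ≤ L →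
            ∃ g : Fock (Orb (FermionTorus 2 L)), IsGroundStateInSector (hubbardTorus 2 L 1 U) (2 * ⌊(1 - δ) * (L : ℝ) ^ 2 / 2⌋₊) 0 g ∧
              star g ⬝ᵥ g = 1 ∧
              c * (L : ℝ) ^ 4 ≤
                (star (pairField dWaveFormFactor L *ᵥ g) ⬝ᵥ (pairField dWaveFormFactor L *ᵥ g)).re) →
      ∃ γ : ℕ → ℝ, Tendsto (fun L : ℕ => γ L * (L : ℝ) ^ 2) atTop atTop ∧
        (∃ L₀ : ℕ, ∀ (L : ℕ) [NeZero L], Even L → L₀ ≤ L →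
              ∀ g : Fock (Orb (FermionTorus 2 L)), IsGroundStateInSector (hubbardTorus 2 L 1 U) (2 * ⌊(1 - δ) * (L : ℝ) ^ 2 / 2⌋₊) 0 g →
                (let H : Matrix (Finset (Orb (FermionTorus 2 L))) (Finset (Orb (FermionTorus 2 L))) ℂ :=
                   hubbardTorus 2 L 1 U
                 let hH : H.IsHermitian := LiebThm1.hamiltonian_isHermitian (fermionTorusGraph 2 L) 1 U
                 let e : ℝ := H.minEnergyOn (szSector ((2 * ⌊(1 - δ) * (L : ℝ) ^ 2 / 2⌋₊) - 2) 0)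
                 let Q : Matrix (Finset (Orb (FermionTorus 2 L))) (Finset (Orb (FermionTorus 2 L))) ℂ :=
                   (hH.eigenvectorUnitary : Matrix (Finset (Orb (FermionTorus 2 L))) (Finset (Orb (FermionTorus 2 L))) ℂ) *
                     Matrix.diagonal (fun i => if e < hH.eigenvalues i ∧ hH.eigenvalues i < e + γ L then (1 : ℂ) else 0) *
                       star (hH.eigenvectorUnitary :
                         Matrix (Finset (Orb (FermionTorus 2 L))) (Finset (Orb (FermionTorus 2 L))) ℂ)
                 let u : Fock (Orb (FermionTorus 2 L)) := pairField dWaveFormFactor L *ᵥ g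
                 (star (Q *ᵥ u) ⬝ᵥ (Q *ᵥ u)).re ≤ (1 / 4) * (star u ⬝ᵥ u).re)) ∧
        (∀ ε : ℝ, 0 < ε → ∃ L₀ : ℕ, ∀ (L : ℕ), Even L → L₀ ≤ L →
              (let e : ℕ → ℝ := fun n => (hubbardTorus 2 L 1 U).minEnergyOn (szSector n 0)
               let N : ℕ := (2 * ⌊(1 - δ) * (L : ℝ) ^ 2 / 2⌋₊)
               2 * e N - e (N + 2) - e (N - 2) ≤ ε * γ L))) :
    JmInterchange := by
  unfold JmInterchange
  intro U δ a J₀ hU hδ ha hJ₀ hG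
  have hF := h₂ U δ hU hδ
    (hypGivesZEPO_of_pigeonhole (fun {ι} _ _ => windowPigeonhole) (fun {ι} _ _ => couplingExpectBound)
      U δ a J₀ hU hδ ha hJ₀ hG)
  obtain ⟨γ, hγ, hlow, hch⟩ := h₃ U δ hU hδ hF
  exact bridgeFromFloorOrderApprox U δ hU hδ γ hγ hlow hch hF

end Summit.HubbardSuperconductivity.HubbardSuperconductivity.Theorems.JosephsonMirror
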